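import Literature.NumberTheory.Kottwitz1992.ComplexPointsLocalIsoRealHolds
import HarnessLib

/-!
# [Kottwitz1992, §8 p. 400] twisting by a central class — DISCHARGED: `Kottwitz1992_8_twist_class_holds`

Kernel-lane companion of the statement carpet ★ `Literature/NumberTheory/Kottwitz1992/ComplexPoints.lean`: the named fact
★ `ComplexPoints.Kottwitz1992_8_twist_class` («Define an automorphism of `S_{K^p}` by sending an `S`-valued point
`(A, λ, i, η̄)` to the point `(A, λ∘i(a), i, βη̄)` …», p. 400, READ on shadows: twisting the form `ψ` of a shadow `(H, ψ)` by a
central `*`-symmetric unit `a ∈ F₀^×` that is locally a norm times a scalar — `a = q · x x*` over `ℝ` and over every `ℚ_ℓ` —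
replaces the class of `V` by the class of `(V, φ_a)`, and `(H, ψ_a)` stays locally isomorphic to `V` everywhere) now has its
`_holds` theorem.

PROOF (the sentence «a being locally a norm times a scalar, `(H, ψ_a)` is again locally isomorphic to `V` everywhere» of the
carpet docstring, made explicit).  Over `ℚ`: a `B`-isomorphism `e : V ≅ H` with `ψ(e v, e w) = c φ(v, w)` also carries `φ_a`
to `c⁻¹`… precisely `ψ_a(e v, e w) = c φ_a(v, w)`, since `e` commutes with the central element `a`.  Over a field `K ⊇ ℚ`
with `jB(a) = q · x ι_K(x)` (`x` a central unit of `B_K`, `q ∈ K^×`): base-change `e` along the two presentations to a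
`B_K`-isomorphism `e_K : V_K ≅ H_K` (universal property of `IsBaseChange`), and put `e' := u · e_K` with the central unit
`u = x⁻¹`; then `ι_K(u) u = (x ι_K x)⁻¹ = q · jB(a⁻¹)`, so by skew-Hermitian-ness of the base change `χ_K` of `ψ_a`
(★ `ComplexPoints.LocalIsoReal.form_smul_left`)
`χ_K(e' v, e' w) = χ_K(e_K v, ι_K(u) u · e_K w) = q · χ_K(e_K v, jB(a⁻¹) e_K w)`, which on generators `v = jV(v₀)`,
`w = jV(w₀)` equals `q · ψ(a e v₀, a⁻¹ e w₀) = q · ψ(e v₀, e w₀) = q c · φ(v₀, w₀)`; two `K`-bilinear forms agreeing on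
generators of the base change agree (`IsBaseChange.algHom_ext`), whence `χ_K(e' v, e' w) = q c · φ_K(v, w)` on `V_K`.
Applied with `K = ℝ` and `K = ℚ_ℓ`.

No new definitions, no new named facts (D-0026): helper lemmas are proved inline (namespace `TwistClass`, folklore plumbing
`private`).

## References
* [Kottwitz1992] R. E. Kottwitz, *Points on some Shimura varieties over finite fields*, J. Amer. Math. Soc. 5 (1992), §8
  p. 400 (with §7 p. 394, `H¹(ℚ, Z) = F₀^× / ℚ^× N_{F/F₀}(F^×)`).
-/

open Module

namespace Literature.NumberTheory.Kottwitz1992.ComplexPoints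

open Literature.NumberTheory.Kottwitz1992.GroupStructure

namespace TwistClass

/-! ## The twisted form `ψ_a` is again skew-Hermitian -/

section Twist

variable {B : Type} [Ring B] [Algebra ℚ B] {ι : B →ₗ[ℚ] B}
variable {H : Type} [AddCommGroup H] [Module ℚ H] [Module B H] {ψ : LinearMap.BilinForm ℚ H}

omit [Algebra ℚ B] in
/-- `ψ_a(h, h') = ψ(a h, h')`. [cite: Kottwitz1992, §8 (p. 400)] -/
theorem twistForm_apply (a : B) (h h' : H) : twistForm ψ a h h' = ψ (a • h) h' := rfl

/-- For `a` central, `*`-fixed and invertible, `ψ_a = ψ(a ·, ·)` is again a nondegenerate skew-Hermitian form (the Riemann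
form of the polarization `λ ∘ i(a)`). [cite: Kottwitz1992, §8 (p. 400)] -/
theorem isSkewHermitian_twistForm (hψ : IsSkewHermitian ℚ ι ψ) {a : B} (ha : a ∈ Subalgebra.center ℚ B)
    (hιa : ι a = a) (hu : IsUnit a) : IsSkewHermitian ℚ ι (twistForm ψ a) := by
  obtain ⟨au, rfl⟩ := hu
  refine ⟨fun h => ?_, ⟨fun h h0 => ?_, fun h' h0 => ?_⟩, fun b h h' => ?_⟩
  · -- alternating: `ψ(a h, h) = ψ(h, a h) = -ψ(a h, h)`
    have h1 : ψ ((au : B) • h) h = ψ h ((au : B) • h) := by rw [hψ.skew, hιa]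
    have h2 := hψ.isAlt.neg_eq h ((au : B) • h)
    show ψ ((au : B) • h) h = 0
    linarith
  · -- left-separating
    have h1 : (au : B) • h = 0 := hψ.nondegenerate.1 _ fun n => h0 n
    rw [← one_smul B h, ← au.inv_mul, ← smul_smul, h1, smul_zero]
  · -- right-separating
    refine hψ.nondegenerate.2 _ fun n => ?_
    have h1 := h0 (((au⁻¹ : Bˣ) : B) • n)
    rwa [twistForm_apply, smul_smul, Units.mul_inv, one_smul] at h1
  · -- skew: `a` is central
    rw [twistForm_apply, twistForm_apply, smul_smul, ← Subalgebra.mem_center_iff.1 ha b, ← smul_smul, hψ.skew]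

end Twist

/-! ## Base change of a `B`-isomorphism along two presentations -/

section BaseChangeIso

variable {K : Type} [Field K] [Algebra ℚ K]
variable {B : Type} [Ring B] [Algebra ℚ B] {ι : B →ₗ[ℚ] B}
variable {V : Type} [AddCommGroup V] [Module ℚ V] [Module B V] [IsScalarTower ℚ B V] {φ : LinearMap.BilinForm ℚ V}
variable {H : Type} [AddCommGroup H] [Module ℚ H] [Module B H] [IsScalarTower ℚ B H] {χ : LinearMap.BilinForm ℚ H}
variable {BK : Type} [Ring BK] [Algebra K BK] [Algebra ℚ BK] [IsScalarTower ℚ K BK] {ιK : BK →ₗ[K] BK}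
  {jB : B →ₐ[ℚ] BK}
variable {VK : Type} [AddCommGroup VK] [Module K VK] [Module ℚ VK] [IsScalarTower ℚ K VK] [Module BK VK]
  [IsScalarTower K BK VK] {φK : LinearMap.BilinForm K VK} {jV : V →ₗ[ℚ] VK}
variable {HK : Type} [AddCommGroup HK] [Module K HK] [Module ℚ HK] [IsScalarTower ℚ K HK] [Module BK HK]
  [IsScalarTower K BK HK] {χK : LinearMap.BilinForm K HK} {jH : H →ₗ[ℚ] HK}

/-- A `B`-linear isomorphism `e : V ≅ H` base-changes, along presentations of `V_K` and `H_K`, to a `B_K`-linear isomorphism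
`e_K : V_K ≅ H_K` with `e_K ∘ jV = jH ∘ e` («the `B_{ℚ_v}`-modules `V_{ℚ_v}` and `H_{ℚ_v}` are isomorphic», §8 p. 399).
[cite: Kottwitz1992, §8 (p. 399)] -/
theorem exists_baseChange_equiv (hB : IsAlgebraExtension ι K ιK jB) (hV : IsModuleExtension φ K jB φK jV)
    (hH : IsModuleExtension χ K jB χK jH) (e : V ≃ₗ[B] H) :
    ∃ eK : VK ≃ₗ[BK] HK, ∀ v : V, eK (jV v) = jH (e v) := by
  let g : VK →ₗ[K] HK := hV.isBaseChange.lift (jH ∘ₗ e.toLinearMap.restrictScalars ℚ)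
  let g' : HK →ₗ[K] VK := hH.isBaseChange.lift (jV ∘ₗ e.symm.toLinearMap.restrictScalars ℚ)
  have hg : ∀ v, g (jV v) = jH (e v) := fun v => hV.isBaseChange.lift_eq _ v
  have hg' : ∀ h, g' (jH h) = jV (e.symm h) := fun h => hH.isBaseChange.lift_eq _ h
  have h₁ : g'.comp g = LinearMap.id :=
    hV.isBaseChange.algHom_ext _ _ fun v => by rw [LinearMap.comp_apply, LinearMap.id_apply, hg, hg', e.symm_apply_apply]
  have h₂ : g.comp g' = LinearMap.id :=
    hH.isBaseChange.algHom_ext _ _ fun h => by rw [LinearMap.comp_apply, LinearMap.id_apply, hg', hg, e.apply_symm_apply]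
  -- `B_K`-linearity of `g`, checked on generators
  have hlin : ∀ (b : BK) (x : VK), g (b • x) = b • g x := fun b x => by
    induction b using hB.isBaseChange.inductionOn generalizing x with
    | zero => simp
    | tmul b₀ =>
      rw [AlgHom.toLinearMap_apply]
      induction x using hV.isBaseChange.inductionOn with
      | zero => simp
      | tmul v => rw [← hV.map_smul, hg, hg, LinearEquiv.map_smul, hH.map_smul]
      | smul s x hx =>
        rw [smul_comm (jB b₀) s x, g.map_smul, hx, g.map_smul]
        exact (smul_comm (jB b₀) s (g x)).symm
      | add x₁ x₂ h1 h2 => rw [smul_add, map_add, map_add, h1, h2, smul_add]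
    | smul s b hb => rw [smul_assoc, g.map_smul, hb, smul_assoc]
    | add b₁ b₂ h1 h2 => rw [add_smul, map_add, h1, h2, add_smul]
  let e₀ : VK ≃ₗ[K] HK := LinearEquiv.ofLinear g g' h₂ h₁
  exact ⟨{ e₀ with map_smul' := fun b x => hlin b x }, fun v => hg v⟩

/-- Two `K`-bilinear forms on `V_K` that agree on `jV(V) × jV(V)` agree. [folklore] -/
private theorem bilin_ext (hV : IsBaseChange K jV) {β₁ β₂ : LinearMap.BilinForm K VK}
    (h : ∀ v w : V, β₁ (jV v) (jV w) = β₂ (jV v) (jV w)) : β₁ = β₂ :=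
  hV.algHom_ext _ _ fun v => hV.algHom_ext _ _ fun w => h v w

end BaseChangeIso

/-! ## The local statement over a field `K ⊇ ℚ` where `a` is a norm times a scalar -/

section Local

variable (K : Type) [Field K] [Algebra ℚ K]
variable {B : Type} [Ring B] [Algebra ℚ B] {ι : B →ₗ[ℚ] B}
variable {V : Type} [AddCommGroup V] [Module ℚ V] [Module B V] [IsScalarTower ℚ B V] {φ : LinearMap.BilinForm ℚ V}
variable {H : Type} [AddCommGroup H] [Module ℚ H] [Module B H] [IsScalarTower ℚ B H] {ψ : LinearMap.BilinForm ℚ H}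

/-- **Twisting by `a = q · x x*` does not change the local class.**  If `(H, ψ) ≅ (V, φ)` over `ℚ` and the central
`*`-symmetric unit `a` is, over `K`, a scalar times a norm from the centre (`CentralClassTrivialOver ι K a`, i.e. `a` represents
the trivial class of `H¹(K, Z)`, «`H¹(ℚ, Z) = F₀^× / ℚ^× N_{F/F₀}(F^×)`»), then `(H, ψ_a)` is isomorphic to `(V, φ)` over `K`:
with `jB(a) = q · x ι_K(x)` and `e_K` the base change of the `ℚ`-isomorphism, `e' = x⁻¹ · e_K` satisfies
`(ψ_a)_K(e' v, e' w) = q c · φ_K(v, w)`. [cite: Kottwitz1992, §8 (p. 400) with §7 (p. 394)] -/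
theorem locallyIsomorphic_twist (hψ : IsSkewHermitian ℚ ι ψ) {a : B} (ha : a ∈ Subalgebra.center ℚ B) (hιa : ι a = a)
    (hu : IsUnit a) (hCT : CentralClassTrivialOver ι K a) (hiso : Isomorphic φ ψ B) :
    LocallyIsomorphic ι φ K (twistForm ψ a) := by
  intro BK _ _ _ _ ιK jB VK _ _ _ _ _ _ φK jV HK _ _ _ _ _ _ χK jH hB hV hH
  obtain ⟨e, c, hec⟩ := hiso
  obtain ⟨q, x, hxc, hxu, hax⟩ := hCT BK ιK jB hB
  obtain ⟨au, rfl⟩ := hu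
  obtain ⟨xu, rfl⟩ := hxu
  have hψa : IsSkewHermitian ℚ ι (twistForm ψ (au : B)) := isSkewHermitian_twistForm hψ ha hιa au.isUnit
  obtain ⟨eK, heK⟩ := exists_baseChange_equiv hB hV hH e
  -- the central unit `u = x⁻¹`, and `ι_K(u) u = q · jB(a⁻¹)`
  have huc : ∀ y : BK, y * ((xu⁻¹ : BKˣ) : BK) = ((xu⁻¹ : BKˣ) : BK) * y := fun y =>
    (Commute.units_inv_right (Subalgebra.mem_center_iff.1 hxc y)).eq
  have hι1 : ιK 1 = 1 := by
    have h := hB.invol_mul (ιK 1) 1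
    rw [mul_one, hB.invol_invol, mul_one] at h
    exact h.symm
  have hkey : ιK ((xu⁻¹ : BKˣ) : BK) * ((xu⁻¹ : BKˣ) : BK) = (q : K) • jB ((au⁻¹ : Bˣ) : B) := by
    apply left_inv_eq_right_inv (a := (xu : BK) * ιK (xu : BK))
    · rw [mul_assoc, ← mul_assoc ((xu⁻¹ : BKˣ) : BK), Units.inv_mul, one_mul, ← hB.invol_mul, Units.mul_inv, hι1]
    · have hx' : (xu : BK) * ιK (xu : BK) = ((q⁻¹ : Kˣ) : K) • jB (au : B) := by
        rw [hax, smul_smul, Units.inv_mul, one_smul]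
      rw [hx', smul_mul_assoc, mul_smul_comm, smul_smul, Units.inv_mul, one_smul, ← map_mul, Units.mul_inv, map_one]
  -- multiplication by `u` as a `B_K`-linear automorphism of `H_K`
  let uE : HK ≃ₗ[BK] HK :=
    { toFun := fun y => ((xu⁻¹ : BKˣ) : BK) • y
      map_add' := fun y₁ y₂ => smul_add _ y₁ y₂
      map_smul' := fun b y => by rw [RingHom.id_apply, smul_smul, smul_smul, huc b]
      invFun := fun y => (xu : BK) • y
      left_inv := fun y => by simp only [smul_smul, Units.mul_inv, one_smul]
      right_inv := fun y => by simp only [smul_smul, Units.inv_mul, one_smul] }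
  have huE : ∀ y, uE y = ((xu⁻¹ : BKˣ) : BK) • y := fun _ => rfl
  refine ⟨eK.trans uE, q * Units.map (algebraMap ℚ K).toMonoidHom c, fun v w => ?_⟩
  -- the identity `χ_K(e' v, e' w) = q c · φ_K(v, w)`, checked on generators
  let E : VK →ₗ[K] HK := (eK.trans uE).toLinearMap.restrictScalars K
  have hE : ∀ v, E v = ((xu⁻¹ : BKˣ) : BK) • eK v := fun _ => rfl
  have key : χK.compl₁₂ E E = ((q : K) * algebraMap ℚ K c) • φK := by
    refine bilin_ext hV.isBaseChange fun v₀ w₀ => ?_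
    rw [LinearMap.compl₁₂_apply, hE, hE, heK, heK, LocalIsoReal.form_smul_left hB hH hψa, smul_smul, hkey, smul_assoc,
      ← hH.map_smul, LinearMap.map_smul, hH.map_form, twistForm_apply, hψ.skew, hιa, smul_smul, Units.mul_inv, one_smul,
      hec, map_mul, ← hV.map_form, LinearMap.smul_apply, LinearMap.smul_apply, smul_eq_mul, smul_eq_mul, mul_assoc]
  have h := LinearMap.congr_fun (LinearMap.congr_fun key v) w
  rw [LinearMap.compl₁₂_apply, LinearMap.smul_apply, LinearMap.smul_apply, smul_eq_mul] at h
  rw [Units.val_mul, Units.coe_map, RingHom.toMonoidHom_eq_coe, MonoidHom.coe_coe]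
  exact h

end Local

end TwistClass

/-! ## The discharge -/

section Shadow

variable {B : Type} [Ring B] [Algebra ℚ B] (ι : B →ₗ[ℚ] B)
variable {V : Type} [AddCommGroup V] [Module ℚ V] [Module B V] [IsScalarTower ℚ B V]
  (φ : LinearMap.BilinForm ℚ V)
variable {H : Type} [AddCommGroup H] [Module ℚ H] [Module B H] [IsScalarTower ℚ B H]
  (ψ : LinearMap.BilinForm ℚ H)

/-- **[Kottwitz1992, §8 p. 400] twisting by a central class — DISCHARGED.**  For the §5 datum, a central `*`-symmetric unit
`a ∈ F₀^×` representing the trivial class of `H¹(K, Z)` over `K = ℝ` and over every `K = ℚ_ℓ`, and a shadow `(H, ψ)` in the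
class of `V` over `ℚ`: `(H, ψ_a)` is in the class of `(V, φ_a)` over `ℚ`, and `(H, ψ_a)` is again locally isomorphic to `V` at
`∞` and at every prime `ℓ` («Define an automorphism of `S_{K^p}` by sending … `(A, λ, i, η̄)` to the point `(A, λ∘i(a), i, βη̄)`»,
`a` «totally positive» and adjusted by `ℚ^× N_{F/F₀}(F^×)`). [cite: Kottwitz1992, §8 (p. 400)] -/
theorem Kottwitz1992_8_twist_class_holds : Kottwitz1992_8_twist_class ι φ ψ := by
  intro _ _ a ha hιa hu hCTℝ hCTℓ hψ hiso
  refine ⟨?_, TwistClass.locallyIsomorphic_twist ℝ hψ ha hιa hu hCTℝ hiso,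
    fun ℓ _ => TwistClass.locallyIsomorphic_twist ℚ_[ℓ] hψ ha hιa hu (hCTℓ ℓ) hiso⟩
  obtain ⟨e, c, hec⟩ := hiso
  refine ⟨e, c, fun v w => ?_⟩
  rw [TwistClass.twistForm_apply, TwistClass.twistForm_apply, ← e.map_smul, hec]

end Shadow

end Literature.NumberTheory.Kottwitz1992.ComplexPoints
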